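import Literature.Analysis.FluidPDE.VeryWeakToDistributionalFour
import Literature.Analysis.FluidPDE.KatoRieszPressureSuitable
import Literature.Analysis.FluidPDE.ForwardMildWeak
import Literature.Analysis.FluidPDE.KNSSTypeIRateLiouvilleMild
import Literature.Analysis.FluidPDE.RieszPressureSpaceTimeLq
import Literature.Analysis.FluidPDE.OseenWindowLpPropagation
import Literature.Analysis.FunctionSpaces.WeakLpQuantitative
import HarnessLib

/-!
# Bounded mild solutions on a window with weak-`L³` datum: weak form, `L⁴` slices, the Riesz
# pressure in `L²`, distributional and suitable weak solution on the slab

Analysis/FluidPDE proof file (theorems only: no definition, no named fact, no `sorry`) on the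
discharge path of the named fact
`Literature.Analysis.FluidPDE.AlbrittonBarker2019_liouville_weakL3_backward`
(`AncientL3BackwardLiouville.lean`; Albritton–Barker, arXiv:1811.00502, **Thm. 4.1**). It is
the first half of hypothesis `hLE` of
`AlbrittonBarker2019_liouville_weakL3_backward_of_localEnergy_of_layer`
(`AncientWeakL3BackwardLiouvilleAssembly.lean`): the blow-down fields of the proof of Thm. 4.1
(arXiv p. 9: "Since `v` is mild, it is not difficult to show that `v^{(k)}` is a weak
`L^{3,∞}` solution") are, on the window `[0, S]`, continuous bounded solutions of the Oseen
integral equation `u(t) = e^{(t−s)Δ}u(s) − B¹_s(u, u)(t)` (`0 ≤ s < t ≤ S`) with weakly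
divergence-free slices and a weak-`L³` datum `u(0)`. For such a field this file proves:

* `isMildNSSolutionOn_Ico_of_oseenForward` — the duality-form mild identity from the datum
  (Lemarié-Rieusset 2016, Thm. 6.1; as in the tree's ancient `isBoundedAncientMildSolution_of_oseen`),
  hence `isBoundedWeakNSSolutionOn_of_oseenForward`, the bounded weak form of KNSS 2009 §4 on
  `(0, S)` (`isBoundedWeakNSSolutionOn_of_isMildNSSolutionOn`);
* `memLp_four_slab_of_oseenForward` — `u ∈ L⁴((0, S) × ℝ³)`: the datum lies in
  `L^{3,∞} ∩ L^∞ ⊂ L⁴` and `L⁴` slices propagate with a uniform bound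
  (`OseenWindowLpPropagation.lean`);
* `exists_rieszPressure_two_slab` — the space–time Riesz pressure `p = Σ ℛᵢℛⱼ(uᵢuⱼ) ∈ L²` of
  an `L⁴` field of the slab (`exists_spaceTime_rieszPressure`, `q = 2`);
* `isDistributionalNSSolutionOn_slab_of_oseenForward` — `(u, p)` solves Navier–Stokes in
  `𝒟'((0,S) × ℝ³)` (`isDistributionalNSSolutionOn_slab_of_veryWeak_four`);
* `isSuitableWeakSolutionOn_slab_of_bounded_of_memLp_two` — and is a suitable weak solution there
  (bounded velocity, `isSuitableWeakSolutionOn_of_bounded` on an exhaustion by boxes, as in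
  `IsKatoSolutionOn.suitable_slab_of_pressure`);
* `exists_rieszPressure_suitable_slab_of_oseenForward` — summary.

## References

* D. Albritton, T. Barker, arXiv:1811.00502, proof of Thm. 4.1 (p. 9). [`AlbrittonBarker2019`]
* T. Barker, G. Seregin, V. Šverák, arXiv:1603.03211, Def. 1.1. [`BarkerSeregin2016`]
* P. G. Lemarié-Rieusset, *The Navier–Stokes Problem in the 21st Century* (2016), Thm. 6.1,
  Prop. 6.5 with Lemma 6.3, (6.13), Def. 6.9; Thm. 15.1 (A), proof p. 565. [`LemarieRieusset2016`]
* G. Koch, N. Nadirashvili, G. Seregin, V. Šverák, Acta Math. 203 (2009) = arXiv:0709.3599, §4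
  (i)–(ii). [`KochNadirashviliSereginSverak2009`]
-/

noncomputable section

open MeasureTheory TopologicalSpace Set Function Filter Metric InnerProductSpace
open _root_.Topology
open scoped ENNReal NNReal RealInnerProductSpace Laplacian

namespace Literature.Analysis.FluidPDE

variable {S : ℝ} {u : ℝ → (EuclideanSpace ℝ (Fin 3)) → (EuclideanSpace ℝ (Fin 3))}

/-! ### The duality-form mild identity and the bounded weak form -/

/-- **The two-time duality identity from the datum** for a continuous bounded solution of the
Oseen integral equation on `[0, S]` (Lemarié-Rieusset 2016, Thm. 6.1, (6.12) ⇒ (6.11): testing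
`u(t) = e^{tΔ}u(0) − B¹_0(u, u)(t)` against a divergence-free test field, the free term is
`∫⟪u(0), e^{tΔ}φ⟫` and the Duhamel term is `∫₀ᵗ∫⟪u, (u·∇)e^{(t−τ)Δ}φ⟫`). [cite: LemarieRieusset2016, Thm. 6.1 ((6.12) ⇒ (6.11))] -/
theorem isMildNSSolutionBetween_zero_of_oseenForward
    (hcont : ContinuousOn (uncurry u) (Icc 0 S ×ˢ univ)) {K : ℝ}
    (hK : ∀ t ∈ Icc 0 S, ∀ x, ‖u t x‖ ≤ K)
    (hmild : ∀ s t : ℝ, 0 ≤ s → s < t → t ≤ S → ∀ x,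
      u t x = UnboundedOperators.heatExtension (u s) (t - s) x - oseenDuhamel 1 s u u t x)
    {t : ℝ} (ht0 : 0 < t) (htS : t ≤ S) : IsMildNSSolutionBetween 1 0 u 0 t := by
  intro φ hφ hφdiv
  have h0I : (0 : ℝ) ∈ Icc 0 S := ⟨le_rfl, ht0.le.trans htS⟩
  have hK0 : 0 ≤ K := (norm_nonneg _).trans (hK 0 h0I 0)
  have hu0c : Continuous (u 0) :=
    hcont.comp_continuous (f := fun x : (EuclideanSpace ℝ (Fin 3)) => ((0 : ℝ), x)) (by fun_prop) fun _ => ⟨h0I, mem_univ _⟩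
  have hts : 0 < t - 0 := by rwa [sub_zero]
  -- measurability of `u` on the window `(0, t) × ℝ³`
  have hmeas : AEStronglyMeasurable (uncurry u) ((volume : Measure (ℝ × (EuclideanSpace ℝ (Fin 3)))).restrict (Ioo 0 t ×ˢ univ)) := by
    refine (hcont.mono ?_).aestronglyMeasurable (measurableSet_Ioo.prod MeasurableSet.univ)
    exact prod_mono (fun τ hτ => ⟨hτ.1.le, hτ.2.le.trans htS⟩) subset_rfl
  have hφc : Continuous φ := hφ.contDiff.continuous
  have hφi : Integrable φ := hφc.integrable_of_hasCompactSupport hφ.hasCompactSupport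
  have hKτ : ∀ τ ∈ Ioo 0 t, ∀ y, ‖u τ y‖ ≤ K := fun τ hτ y => hK τ ⟨hτ.1.le, hτ.2.le.trans htS⟩ y
  -- the two pairings of the representation formula
  have h1 : Integrable (fun x => ⟪UnboundedOperators.heatExtension (u 0) (t - 0) x, φ x⟫) :=
    integrable_inner_of_aestronglyMeasurable_of_norm_le
      ((UnboundedOperators.contDiff_heatExtension_of_bound (m := 0) hu0c
        (fun z => hK 0 h0I z) hts).continuous.aestronglyMeasurable)
      (fun x => UnboundedOperators.norm_heatExtension_le_of_bound (fun z => hK 0 h0I z) hts x) hφi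
  have h2 : Integrable (fun x => ⟪oseenDuhamel 1 0 u u t x, φ x⟫) := by
    obtain ⟨C, hC, hB⟩ := exists_norm_oseenDuhamel_bounded_le (E := (EuclideanSpace ℝ (Fin 3)))
    exact integrable_inner_of_aestronglyMeasurable_of_norm_le
      (aestronglyMeasurable_oseenDuhamel one_pos hmeas hmeas hK0 hKτ hKτ ht0 le_rfl)
      (fun x => hB one_pos ht0 hK0 hKτ hKτ x) hφi
  -- assemble
  have hlhs : (fun x => ⟪u t x, φ x⟫) = fun x =>
      ⟪UnboundedOperators.heatExtension (u 0) (t - 0) x, φ x⟫ - ⟪oseenDuhamel 1 0 u u t x, φ x⟫ := by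
    funext x
    rw [hmild 0 t le_rfl ht0 htS x, inner_sub_left]
  rw [hlhs, integral_sub h1 h2,
    integral_inner_heatExtension_comm_of_bound hu0c.aestronglyMeasurable
      (fun z => hK 0 h0I z) hφc hφ.hasCompactSupport hts,
    integral_inner_oseenDuhamel_eq_neg_intervalIntegral one_pos hmeas hK0 hKτ ht0 le_rfl hφ hφdiv,
    heatTest_of_pos one_pos hts, one_mul]
  simp

/-- **A continuous bounded solution of the Oseen integral equation on `[0, S]` with weakly
divergence-free slices is a mild solution in duality form from its datum** on `[0, S)`
(`IsMildNSSolutionOn (Ico 0 S) 1 0 (u 0) u`; Lemarié-Rieusset 2016, Thm. 6.1). [cite: LemarieRieusset2016, Thm. 6.1 ((6.12) ⇒ (6.11))] -/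
theorem isMildNSSolutionOn_Ico_of_oseenForward
    (hcont : ContinuousOn (uncurry u) (Icc 0 S ×ˢ univ)) {K : ℝ}
    (hK : ∀ t ∈ Icc 0 S, ∀ x, ‖u t x‖ ≤ K) (hdiv : ∀ t ∈ Icc 0 S, IsWeaklyDivFree (u t))
    (hmild : ∀ s t : ℝ, 0 ≤ s → s < t → t ≤ S → ∀ x,
      u t x = UnboundedOperators.heatExtension (u s) (t - s) x - oseenDuhamel 1 s u u t x) :
    IsMildNSSolutionOn (Ico 0 S) 1 0 (u 0) u := by
  refine ⟨fun t ht => hdiv t (Ico_subset_Icc_self ht), fun t ht => isMildNSSolutionFrom_self_iff.2 ?_⟩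
  rcases ht.1.eq_or_lt with h | h
  · subst h
    intro φ hφ hφdiv
    simp [heatTest]
  · exact isMildNSSolutionBetween_zero_of_oseenForward hcont hK hmild h ht.2.le

/-- **… hence a bounded weak solution on `ℝ³ × (0, S)` in KNSS's sense** (KNSS 2009, §4
(i)–(ii); `isBoundedWeakNSSolutionOn_of_isMildNSSolutionOn`). [cite: KochNadirashviliSereginSverak2009, §4 (i)–(ii) (arXiv:0709.3599 p. 8)] -/
theorem isBoundedWeakNSSolutionOn_of_oseenForward (hS : 0 < S)
    (hcont : ContinuousOn (uncurry u) (Icc 0 S ×ˢ univ)) {K : ℝ}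
    (hK : ∀ t ∈ Icc 0 S, ∀ x, ‖u t x‖ ≤ K) (hdiv : ∀ t ∈ Icc 0 S, IsWeaklyDivFree (u t))
    (hmild : ∀ s t : ℝ, 0 ≤ s → s < t → t ≤ S → ∀ x,
      u t x = UnboundedOperators.heatExtension (u s) (t - s) x - oseenDuhamel 1 s u u t x) :
    IsBoundedWeakNSSolutionOn (Ioo 0 S) isOpen_Ioo 1 u := by
  have hmild' := isMildNSSolutionOn_Ico_of_oseenForward hcont hK hdiv hmild
  have hslc : ∀ t ∈ Icc 0 S, Continuous (u t) := fun t ht =>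
    hcont.comp_continuous (f := fun x : (EuclideanSpace ℝ (Fin 3)) => (t, x)) (by fun_prop) fun _ => ⟨ht, mem_univ _⟩
  have hmeas : AEStronglyMeasurable (uncurry u) ((volume : Measure (ℝ × (EuclideanSpace ℝ (Fin 3)))).restrict (Ioo 0 S ×ˢ univ)) :=
    (hcont.mono (prod_mono Ioo_subset_Icc_self subset_rfl)).aestronglyMeasurable
      (measurableSet_Ioo.prod MeasurableSet.univ)
  exact isBoundedWeakNSSolutionOn_of_isMildNSSolutionOn one_pos hS hmild'
    (fun t ht x => hK t (Ico_subset_Icc_self ht) x)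
    (fun t ht => (hslc t (Ico_subset_Icc_self ht)).aestronglyMeasurable) hmeas

/-! ### `L⁴` slices and `u ∈ L⁴` of the slab -/

/-- **The slices of a bounded Oseen-mild solution on `[0, S]` with weak-`L³` datum are in `L⁴`,
uniformly**: `u(0) ∈ L^{3,∞} ∩ L^∞ ⊂ L⁴` (`MemWeakLp.memLp_of_norm_le`) and `L⁴` slices
propagate along the window with a uniform bound
(`oseenWindow_exists_forall_memLp_eLpNorm_le`). [cite: LemarieRieusset2016, §9.9 (PDF p. 260)] -/
theorem exists_forall_memLp_four_of_oseenForward (hS : 0 < S)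
    (hcont : ContinuousOn (uncurry u) (Icc 0 S ×ˢ univ)) {K : ℝ}
    (hK : ∀ t ∈ Icc 0 S, ∀ x, ‖u t x‖ ≤ K)
    (hmild : ∀ s t : ℝ, 0 ≤ s → s < t → t ≤ S → ∀ x,
      u t x = UnboundedOperators.heatExtension (u s) (t - s) x - oseenDuhamel 1 s u u t x)
    (h0 : FunctionSpaces.MemWeakLp (u 0) 3 volume) :
    ∃ B : ℝ≥0∞, B < ∞ ∧ ∀ t ∈ Icc 0 S, MemLp (u t) 4 volume ∧ eLpNorm (u t) 4 volume ≤ B := by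
  have h0I : (0 : ℝ) ∈ Icc 0 S := ⟨le_rfl, hS.le⟩
  have h04 : MemLp (u 0) 4 volume :=
    h0.memLp_of_norm_le (K := max K 1) (lt_max_of_lt_right one_pos)
      (fun x => (hK 0 h0I x).trans (le_max_left _ _)) (by norm_num) ENNReal.ofNat_ne_top
  exact oseenWindow_exists_forall_memLp_eLpNorm_le (p := 4) (by norm_num) ENNReal.ofNat_ne_top hS
    hcont hK hmild h04

/-- **`u ∈ L⁴((0, S) × ℝ³)`** for a bounded Oseen-mild solution on `[0, S]` with weak-`L³` datum
(Tonelli and the uniform bound of the `L⁴` slices). [folklore] -/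
theorem memLp_four_slab_of_oseenForward (hS : 0 < S)
    (hcont : ContinuousOn (uncurry u) (Icc 0 S ×ˢ univ)) {K : ℝ}
    (hK : ∀ t ∈ Icc 0 S, ∀ x, ‖u t x‖ ≤ K)
    (hmild : ∀ s t : ℝ, 0 ≤ s → s < t → t ≤ S → ∀ x,
      u t x = UnboundedOperators.heatExtension (u s) (t - s) x - oseenDuhamel 1 s u u t x)
    (h0 : FunctionSpaces.MemWeakLp (u 0) 3 volume) :
    MemLp (uncurry u) 4 (volume.restrict (Ioo 0 S ×ˢ (univ : Set (EuclideanSpace ℝ (Fin 3))))) := by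
  obtain ⟨B, hBtop, hB⟩ := exists_forall_memLp_four_of_oseenForward hS hcont hK hmild h0
  have hmeas : AEStronglyMeasurable (uncurry u) ((volume : Measure (ℝ × (EuclideanSpace ℝ (Fin 3)))).restrict (Ioo 0 S ×ˢ univ)) :=
    (hcont.mono (prod_mono Ioo_subset_Icc_self subset_rfl)).aestronglyMeasurable
      (measurableSet_Ioo.prod MeasurableSet.univ)
  refine ⟨hmeas, ?_⟩
  rw [eLpNorm_lt_top_iff_lintegral_rpow_enorm_lt_top (by norm_num) ENNReal.ofNat_ne_top]
  have hprod : (volume : Measure (ℝ × (EuclideanSpace ℝ (Fin 3)))).restrict (Ioo 0 S ×ˢ (univ : Set (EuclideanSpace ℝ (Fin 3)))) =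
      ((volume : Measure ℝ).restrict (Ioo 0 S)).prod (volume : Measure (EuclideanSpace ℝ (Fin 3))) := by
    rw [show (volume : Measure (ℝ × (EuclideanSpace ℝ (Fin 3)))) = (volume : Measure ℝ).prod (volume : Measure (EuclideanSpace ℝ (Fin 3))) from rfl,
      ← Measure.restrict_univ (μ := (volume : Measure (EuclideanSpace ℝ (Fin 3)))), Measure.prod_restrict,
      Measure.restrict_univ]
  rw [hprod] at hmeas ⊢
  rw [lintegral_prod _ (hmeas.aemeasurable.enorm.pow_const _)]
  have hslice : ∀ t ∈ Ioo 0 S, ∫⁻ x, ‖uncurry u (t, x)‖ₑ ^ (4 : ℝ≥0∞).toReal ≤ B ^ (4 : ℝ≥0∞).toReal := by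
    intro t ht
    have e : ∫⁻ x, ‖uncurry u (t, x)‖ₑ ^ (4 : ℝ≥0∞).toReal = eLpNorm (u t) 4 volume ^ (4 : ℝ≥0∞).toReal := by
      rw [eLpNorm_eq_eLpNorm' (by norm_num) ENNReal.ofNat_ne_top,
        ← lintegral_rpow_enorm_eq_rpow_eLpNorm' (by norm_num)]
      rfl
    rw [e]
    exact ENNReal.rpow_le_rpow (hB t (Ioo_subset_Icc_self ht)).2 ENNReal.toReal_nonneg
  calc ∫⁻ t in Ioo 0 S, ∫⁻ x, ‖uncurry u (t, x)‖ₑ ^ (4 : ℝ≥0∞).toReal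
      ≤ ∫⁻ _ in Ioo 0 S, B ^ (4 : ℝ≥0∞).toReal := setLIntegral_mono measurable_const hslice
    _ = B ^ (4 : ℝ≥0∞).toReal * volume (Ioo 0 S) := setLIntegral_const _ _
    _ < ∞ := ENNReal.mul_lt_top (ENNReal.rpow_lt_top_of_nonneg (by positivity) hBtop.ne)
        measure_Ioo_lt_top

/-! ### The Riesz pressure of an `L⁴` field of the slab -/

/-- **The space–time Riesz pressure `p = Σ ℛᵢℛⱼ(uᵢuⱼ) ∈ L²` of an `L⁴` field of the slab**
(`exists_spaceTime_rieszPressure` at `q = 2`, applied to the extension of `u` by zero): `p` is in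
`L²((0,S) × ℝ³)` and for a.e. `t ∈ (0, S)` the slice `p(t) ∈ L²` solves the weak Poisson
equation `∫ p(t) Δφ = -∫ D²φ(u(t), u(t))`. [cite: LemarieRieusset2016, Prop. 6.5 / Def. 6.9 (p. 136)] -/
theorem exists_rieszPressure_two_slab
    (hu4 : MemLp (uncurry u) 4 (volume.restrict (Ioo 0 S ×ˢ (univ : Set (EuclideanSpace ℝ (Fin 3)))))) :
    ∃ p : ℝ → (EuclideanSpace ℝ (Fin 3)) → ℝ, MemLp (uncurry p) 2 (volume.restrict (Ioo 0 S ×ˢ (univ : Set (EuclideanSpace ℝ (Fin 3))))) ∧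
      ∀ᵐ t ∂(volume.restrict (Ioo 0 S)), MemLp (p t) 2 volume ∧
        ∀ φ : (EuclideanSpace ℝ (Fin 3)) → ℝ, ContDiff ℝ (⊤ : ℕ∞) φ → HasCompactSupport φ →
          ∫ x, p t x * (Δ φ) x = -∫ x, fderiv ℝ (fderiv ℝ φ) x (u t x) (u t x) := by
  have hslab : MeasurableSet (Ioo 0 S ×ˢ (univ : Set (EuclideanSpace ℝ (Fin 3)))) := measurableSet_Ioo.prod MeasurableSet.univ
  set U : ℝ × (EuclideanSpace ℝ (Fin 3)) → (EuclideanSpace ℝ (Fin 3)) := (Ioo 0 S ×ˢ (univ : Set (EuclideanSpace ℝ (Fin 3)))).indicator (uncurry u) with hU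
  have hU4 : MemLp U 4 volume := (memLp_indicator_iff_restrict hslab).2 hu4
  obtain ⟨C, hC⟩ := RieszPressureLq.exists_spaceTime_rieszPressure (q := 2) one_lt_two
  have e2 : ENNReal.ofReal (2 : ℝ) = 2 := ENNReal.ofReal_ofNat 2
  have e4 : ENNReal.ofReal (2 : ℝ) * 2 = 4 := by rw [e2]; norm_num
  have hU4' : MemLp U (ENNReal.ofReal (2 : ℝ) * 2) volume := by rwa [e4]
  obtain ⟨Q, hQ2, -, hQsl⟩ := hC U hU4'
  rw [e2] at hQ2
  refine ⟨fun t x => Q (t, x), ?_, ?_⟩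
  · have e : (uncurry fun t x => Q (t, x)) = Q := by funext ⟨t, x⟩; rfl
    rw [e]
    exact hQ2.restrict _
  · have h1 : ∀ᵐ t ∂(volume.restrict (Ioo 0 S)), MemLp (fun y => U (t, y)) (ENNReal.ofReal 2 * 2) volume ∧
        MemLp (fun y => Q (t, y)) (ENNReal.ofReal 2) volume ∧
        ∀ φ : (EuclideanSpace ℝ (Fin 3)) → ℝ, ContDiff ℝ (⊤ : ℕ∞) φ → HasCompactSupport φ →
          ∫ y, Q (t, y) * (Δ φ) y = -∫ y, fderiv ℝ (fderiv ℝ φ) y (U (t, y)) (U (t, y)) :=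
      ae_restrict_of_ae hQsl
    filter_upwards [h1, ae_restrict_mem measurableSet_Ioo] with t ht htI
    have hUt : ∀ y, U (t, y) = u t y := fun y => by
      rw [hU, indicator_of_mem (show ((t, y) : ℝ × (EuclideanSpace ℝ (Fin 3))) ∈ Ioo 0 S ×ˢ univ from ⟨htI, mem_univ _⟩)]; rfl
    refine ⟨by rw [e2] at ht; exact ht.2.1, fun φ hφ hφc => ?_⟩
    have h := ht.2.2 φ hφ hφc
    simp only [hUt] at h
    exact h

/-! ### Distributional solution on the slab -/

/-- **The weak divergence constraint on the slab** from weakly divergence-free slices: for a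
locally integrable field `u` on `(0,S) × ℝ³` with `u(t)` weakly divergence free for all
`t ∈ [0, S]`, `∫∫ ⟪u, ∇ₓθ⟫ = 0` for every scalar test function `θ ∈ C_c^∞((0,S) × ℝ³)` (Fubini;
CKN 1982, (2.2)). [cite: CaffarelliKohnNirenberg1982, §2 (2.2)] -/
theorem setIntegral_inner_gradient_eq_zero_of_forall_isWeaklyDivFree
    (hu1 : LocallyIntegrableOn (uncurry u)
      ((slab (EuclideanSpace ℝ (Fin 3)) (Ioo 0 S) isOpen_Ioo : Opens (ℝ × (EuclideanSpace ℝ (Fin 3)))) : Set (ℝ × (EuclideanSpace ℝ (Fin 3)))) volume)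
    (hdiv : ∀ t ∈ Icc 0 S, IsWeaklyDivFree (u t))
    {θ : ℝ → (EuclideanSpace ℝ (Fin 3)) → ℝ} (hθ : IsSpaceTimeTestOn (slab (EuclideanSpace ℝ (Fin 3)) (Ioo 0 S) isOpen_Ioo) θ) :
    ∫ z in Ioo 0 S ×ˢ (univ : Set (EuclideanSpace ℝ (Fin 3))), ⟪u z.1 z.2, gradient (θ z.1) z.2⟫ = 0 := by
  obtain ⟨-, -, hw0⟩ := hθ.continuous_gradient_field
  have hKQ : tsupport (uncurry θ) ⊆ ((slab (EuclideanSpace ℝ (Fin 3)) (Ioo 0 S) isOpen_Ioo : Opens (ℝ × (EuclideanSpace ℝ (Fin 3)))) : Set (ℝ × (EuclideanSpace ℝ (Fin 3)))) :=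
    hθ.tsupport_subset
  refine setIntegral_inner_gradient_eq_zero_of_iterated (Q := slab (EuclideanSpace ℝ (Fin 3)) (Ioo 0 S) isOpen_Ioo) hu1
    (fun φ hφ => ?_) hθ
  obtain ⟨-, -, hφ0⟩ := hφ.continuous_gradient_field
  have hφQ : tsupport (uncurry φ) ⊆ ((slab (EuclideanSpace ℝ (Fin 3)) (Ioo 0 S) isOpen_Ioo : Opens (ℝ × (EuclideanSpace ℝ (Fin 3)))) : Set (ℝ × (EuclideanSpace ℝ (Fin 3)))) :=
    hφ.tsupport_subset
  have hslice : ∀ t, ∫ x, ⟪u t x, gradient (φ t) x⟫ = 0 := by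
    intro t
    by_cases ht : t ∈ Ioo 0 S
    · exact hdiv t (Ioo_subset_Icc_self ht) (φ t) ((hφ.mono le_top).isTestFunctionOn_slice t)
    · refine integral_eq_zero_of_ae (Eventually.of_forall fun x => ?_)
      have hz : ((t, x) : ℝ × (EuclideanSpace ℝ (Fin 3))) ∉ tsupport (uncurry φ) := fun h => ht (mem_slab.1 (hφQ h))
      simp only [hφ0 (t, x) hz, inner_zero_right, Pi.zero_apply]
  simp only [hslice, integral_zero]

/-- **A bounded Oseen-mild solution on `[0, S]` with weak-`L³` datum, paired with its Riesz
pressure, solves Navier–Stokes in the sense of distributions on `(0, S) × ℝ³`**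
(`isDistributionalNSSolutionOn_slab_of_veryWeak_four` fed with the bounded weak form, the weak
divergence constraint of the slices and the weak Poisson equation of the pressure slices;
Lemarié-Rieusset 2016, Prop. 6.5). [cite: LemarieRieusset2016, Def. 6.2 with Lemma 6.3 (file p. 126), (6.13) (p. 135), Prop. 6.5 with Def. 6.9 (p. 136)] -/
theorem isDistributionalNSSolutionOn_slab_of_oseenForward (hS : 0 < S)
    (hcont : ContinuousOn (uncurry u) (Icc 0 S ×ˢ univ)) {K : ℝ}
    (hK : ∀ t ∈ Icc 0 S, ∀ x, ‖u t x‖ ≤ K) (hdiv : ∀ t ∈ Icc 0 S, IsWeaklyDivFree (u t))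
    (hmild : ∀ s t : ℝ, 0 ≤ s → s < t → t ≤ S → ∀ x,
      u t x = UnboundedOperators.heatExtension (u s) (t - s) x - oseenDuhamel 1 s u u t x)
    (hu4 : MemLp (uncurry u) 4 (volume.restrict (Ioo 0 S ×ˢ (univ : Set (EuclideanSpace ℝ (Fin 3))))))
    {p : ℝ → (EuclideanSpace ℝ (Fin 3)) → ℝ} (hp2 : MemLp (uncurry p) 2 (volume.restrict (Ioo 0 S ×ˢ (univ : Set (EuclideanSpace ℝ (Fin 3))))))
    (hsl : ∀ᵐ t ∂(volume.restrict (Ioo 0 S)), ∀ φ : (EuclideanSpace ℝ (Fin 3)) → ℝ, ContDiff ℝ (⊤ : ℕ∞) φ →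
      HasCompactSupport φ → ∫ x, p t x * (Δ φ) x = -∫ x, fderiv ℝ (fderiv ℝ φ) x (u t x) (u t x)) :
    IsDistributionalNSSolutionOn (slab (EuclideanSpace ℝ (Fin 3)) (Ioo 0 S) isOpen_Ioo) 1 0 u p := by
  have hu1 : LocallyIntegrableOn (uncurry u)
      ((slab (EuclideanSpace ℝ (Fin 3)) (Ioo 0 S) isOpen_Ioo : Opens (ℝ × (EuclideanSpace ℝ (Fin 3)))) : Set (ℝ × (EuclideanSpace ℝ (Fin 3)))) volume :=
    locallyIntegrableOn_slab_of_memLp hu4 (by norm_num)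
  have hu2 : LocallyIntegrableOn (fun z => ‖uncurry u z‖ ^ 2)
      ((slab (EuclideanSpace ℝ (Fin 3)) (Ioo 0 S) isOpen_Ioo : Opens (ℝ × (EuclideanSpace ℝ (Fin 3)))) : Set (ℝ × (EuclideanSpace ℝ (Fin 3)))) volume :=
    locallyIntegrableOn_slab_of_memLp (memLp_norm_sq_of_memLp_four hu4) (by norm_num)
  have hp1 : LocallyIntegrableOn (uncurry p)
      ((slab (EuclideanSpace ℝ (Fin 3)) (Ioo 0 S) isOpen_Ioo : Opens (ℝ × (EuclideanSpace ℝ (Fin 3)))) : Set (ℝ × (EuclideanSpace ℝ (Fin 3)))) volume :=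
    locallyIntegrableOn_slab_of_memLp hp2 (by norm_num)
  have hBW := isBoundedWeakNSSolutionOn_of_oseenForward hS hcont hK hdiv hmild
  refine isDistributionalNSSolutionOn_slab_of_veryWeak_four hu4 hp2 (fun θ hθ => ?_) (fun θ hθ => ?_)
    (fun ψ hψ hdivψ => ?_)
  · exact setIntegral_inner_gradient_eq_zero_of_forall_isWeaklyDivFree hu1 hdiv hθ
  · exact setIntegral_pressure_laplacian_eq_of_ae_slice hu1 hu2 hp1 hsl hθ
  · exact setIntegral_veryWeak_eq_zero_of_iterated hu1 hu2 hψ (hBW.2.2.2 ψ hψ hdivψ)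

/-! ### Suitability on the slab -/

/-- **A bounded distributional solution on the slab with pressure in `L²` is a suitable weak
solution on the slab** (Lemarié-Rieusset 2016, Thm. 15.1 (A), proof p. 565, "bounded, hence
suitable": `isSuitableWeakSolutionOn_of_bounded` on the exhaustion of `(0, S) × ℝ³` by the boxes
`(S/(n+2), S) × B(0, n+1)`, of finite volume, on which `p ∈ L² ⊂ L^{3/2}`; as in the tree's
`IsKatoSolutionOn.suitable_slab_of_pressure`). [cite: LemarieRieusset2016, Thm. 15.1 (A), proof (file p. 565)] -/
theorem isSuitableWeakSolutionOn_slab_of_bounded_of_memLp_two (hS : 0 < S) {K : ℝ}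
    (hK : ∀ t ∈ Icc 0 S, ∀ x, ‖u t x‖ ≤ K) {p : ℝ → (EuclideanSpace ℝ (Fin 3)) → ℝ}
    (hNS : IsDistributionalNSSolutionOn (slab (EuclideanSpace ℝ (Fin 3)) (Ioo 0 S) isOpen_Ioo) 1 0 u p)
    (hp2 : MemLp (uncurry p) 2 (volume.restrict (Ioo 0 S ×ˢ (univ : Set (EuclideanSpace ℝ (Fin 3)))))) :
    IsSuitableWeakSolutionOn (slab (EuclideanSpace ℝ (Fin 3)) (Ioo 0 S) isOpen_Ioo) 1 0 u p := by
  -- the exhaustion of the slab by the boxes `Ωₙ = (S/(n+2), S) × B_{n+1}(0)`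
  let Qn : ℕ → Opens (ℝ × (EuclideanSpace ℝ (Fin 3))) := fun n =>
    ⟨Ioo (S / (n + 2)) S ×ˢ ball (0 : (EuclideanSpace ℝ (Fin 3))) (n + 1), isOpen_Ioo.prod isOpen_ball⟩
  have hQn : ∀ n, ((Qn n : Opens (ℝ × (EuclideanSpace ℝ (Fin 3)))) : Set (ℝ × (EuclideanSpace ℝ (Fin 3)))) = Ioo (S / (n + 2)) S ×ˢ ball (0 : (EuclideanSpace ℝ (Fin 3))) (n + 1) :=
    fun n => rfl
  have hpos : ∀ n : ℕ, 0 < S / (n + 2) := fun n => by positivity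
  have hsubn : ∀ n : ℕ, Ioo (S / (n + 2)) S ×ˢ ball (0 : (EuclideanSpace ℝ (Fin 3))) (n + 1) ⊆ Ioo 0 S ×ˢ univ :=
    fun n => prod_mono (Ioo_subset_Ioo_left (hpos n).le) (subset_univ _)
  have hle : ∀ n, Qn n ≤ slab (EuclideanSpace ℝ (Fin 3)) (Ioo 0 S) isOpen_Ioo := fun n z hz => by
    have hz' : z ∈ Ioo (S / (n + 2)) S ×ˢ ball (0 : (EuclideanSpace ℝ (Fin 3))) (n + 1) := hz
    exact mem_slab.2 ⟨(hpos n).trans hz'.1.1, hz'.1.2⟩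
  have hmono : Monotone Qn := by
    refine monotone_nat_of_le_succ fun n z hz => ?_
    have hz' : z ∈ Ioo (S / (n + 2)) S ×ˢ ball (0 : (EuclideanSpace ℝ (Fin 3))) (n + 1) := hz
    change z ∈ Ioo (S / ((n + 1 : ℕ) + 2)) S ×ˢ ball (0 : (EuclideanSpace ℝ (Fin 3))) ((n + 1 : ℕ) + 1)
    push_cast
    refine ⟨⟨lt_of_le_of_lt ?_ hz'.1.1, hz'.1.2⟩, ball_subset_ball (by linarith) hz'.2⟩
    exact div_le_div_of_nonneg_left hS.le (by positivity) (by linarith)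
  have hcov : ∀ K' ⊆ ((slab (EuclideanSpace ℝ (Fin 3)) (Ioo 0 S) isOpen_Ioo : Opens (ℝ × (EuclideanSpace ℝ (Fin 3)))) : Set (ℝ × (EuclideanSpace ℝ (Fin 3)))),
      IsCompact K' → ∃ n, K' ⊆ (Qn n : Set (ℝ × (EuclideanSpace ℝ (Fin 3)))) := by
    intro K' hK' hK'c
    rcases K'.eq_empty_or_nonempty with rfl | hne
    · exact ⟨0, empty_subset _⟩
    obtain ⟨zmin, hzminK, hzmin⟩ := hK'c.exists_isMinOn hne continuous_fst.continuousOn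
    have ha : 0 < zmin.1 := (mem_slab.1 (hK' hzminK)).1
    obtain ⟨R, -, hR⟩ := (hK'c.image continuous_snd).isBounded.subset_ball_lt 0 (0 : (EuclideanSpace ℝ (Fin 3)))
    obtain ⟨n, hn⟩ := exists_nat_gt (max (S / zmin.1) R)
    have hn1 : S / zmin.1 < n := (le_max_left _ _).trans_lt hn
    have hn2 : R < n := (le_max_right _ _).trans_lt hn
    refine ⟨n, fun z hz => ?_⟩
    rw [hQn]
    refine ⟨⟨?_, (mem_slab.1 (hK' hz)).2⟩, ?_⟩
    · have h1 : zmin.1 ≤ z.1 := hzmin hz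
      have h2 : S / (n + 2) < zmin.1 := by
        rw [div_lt_iff₀ (by positivity)]
        rw [div_lt_iff₀ ha] at hn1
        nlinarith
      exact h2.trans_le h1
    · have hz2 : z.2 ∈ ball (0 : (EuclideanSpace ℝ (Fin 3))) R := hR (mem_image_of_mem _ hz)
      exact ball_subset_ball (by linarith) hz2
  refine IsSuitableWeakSolutionOn.of_exhaustion hle hmono hcov fun n => ?_
  -- on each box: finite measure, `u` bounded, `p ∈ L² ⊂ L^{3/2}`
  have hvol : volume ((Qn n : Opens (ℝ × (EuclideanSpace ℝ (Fin 3)))) : Set (ℝ × (EuclideanSpace ℝ (Fin 3)))) < ∞ := by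
    rw [hQn, show (volume : Measure (ℝ × (EuclideanSpace ℝ (Fin 3)))) = (volume : Measure ℝ).prod (volume : Measure (EuclideanSpace ℝ (Fin 3))) from rfl,
      Measure.prod_prod]
    exact ENNReal.mul_lt_top measure_Ioo_lt_top measure_ball_lt_top
  have hM' : ∀ᵐ z ∂(volume.restrict ((Qn n : Opens (ℝ × (EuclideanSpace ℝ (Fin 3)))) : Set (ℝ × (EuclideanSpace ℝ (Fin 3))))), ‖u z.1 z.2‖ ≤ K := by
    rw [hQn]
    filter_upwards [ae_restrict_mem (measurableSet_Ioo.prod measurableSet_ball)] with z hz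
    exact hK z.1 ⟨((hpos n).trans hz.1.1).le, hz.1.2.le⟩ z.2
  have hp' : ∫⁻ z in ((Qn n : Opens (ℝ × (EuclideanSpace ℝ (Fin 3)))) : Set (ℝ × (EuclideanSpace ℝ (Fin 3)))), ‖p z.1 z.2‖ₑ ^ (3 / 2 : ℝ) < ∞ := by
    rw [hQn]
    haveI : IsFiniteMeasure (volume.restrict (Ioo (S / (n + 2)) S ×ˢ ball (0 : (EuclideanSpace ℝ (Fin 3))) (n + 1))) := by
      refine ⟨?_⟩
      rw [Measure.restrict_apply_univ]
      rw [hQn] at hvol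
      exact hvol
    have h2 : MemLp (uncurry p) 2 (volume.restrict (Ioo (S / (n + 2)) S ×ˢ ball (0 : (EuclideanSpace ℝ (Fin 3))) (n + 1))) :=
      hp2.mono_measure (Measure.restrict_mono (hsubn n) le_rfl)
    have h32le : (3 / 2 : ℝ≥0∞) ≤ 2 := by
      rw [ENNReal.div_le_iff (by norm_num) (by norm_num)]; norm_num
    have h32 : MemLp (uncurry p) (3 / 2) (volume.restrict (Ioo (S / (n + 2)) S ×ˢ ball (0 : (EuclideanSpace ℝ (Fin 3))) (n + 1))) :=
      h2.mono_exponent h32le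
    exact lintegral_enorm_rpow_lt_top_of_memLp_threeHalves h32
  exact isSuitableWeakSolutionOn_of_bounded one_pos (hNS.of_le (hle n)) hvol hM' hp'

/-! ### Summary -/

/-- **Summary**: a bounded continuous solution of the Oseen integral equation on `[0, S]` with
weakly divergence-free slices and a weak-`L³` datum lies in `L⁴((0,S) × ℝ³)` and, with its
space–time Riesz pressure `p ∈ L²((0,S) × ℝ³)` (slices solving the weak Poisson equation), is a
suitable weak solution of the unforced Navier–Stokes equations on the open slab `(0, S) × ℝ³`.
[cite: LemarieRieusset2016, Prop. 6.5 with Def. 6.9 (p. 136); Thm. 15.1 (A), proof (file p. 565)] -/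
theorem exists_rieszPressure_suitable_slab_of_oseenForward (hS : 0 < S)
    (hcont : ContinuousOn (uncurry u) (Icc 0 S ×ˢ univ)) {K : ℝ}
    (hK : ∀ t ∈ Icc 0 S, ∀ x, ‖u t x‖ ≤ K) (hdiv : ∀ t ∈ Icc 0 S, IsWeaklyDivFree (u t))
    (hmild : ∀ s t : ℝ, 0 ≤ s → s < t → t ≤ S → ∀ x,
      u t x = UnboundedOperators.heatExtension (u s) (t - s) x - oseenDuhamel 1 s u u t x)
    (h0 : FunctionSpaces.MemWeakLp (u 0) 3 volume) :
    ∃ p : ℝ → (EuclideanSpace ℝ (Fin 3)) → ℝ, MemLp (uncurry u) 4 (volume.restrict (Ioo 0 S ×ˢ (univ : Set (EuclideanSpace ℝ (Fin 3))))) ∧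
      MemLp (uncurry p) 2 (volume.restrict (Ioo 0 S ×ˢ (univ : Set (EuclideanSpace ℝ (Fin 3))))) ∧
      (∀ᵐ t ∂(volume.restrict (Ioo 0 S)), MemLp (p t) 2 volume ∧
        ∀ φ : (EuclideanSpace ℝ (Fin 3)) → ℝ, ContDiff ℝ (⊤ : ℕ∞) φ → HasCompactSupport φ →
          ∫ x, p t x * (Δ φ) x = -∫ x, fderiv ℝ (fderiv ℝ φ) x (u t x) (u t x)) ∧
      IsSuitableWeakSolutionOn (slab (EuclideanSpace ℝ (Fin 3)) (Ioo 0 S) isOpen_Ioo) 1 0 u p := by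
  have hu4 := memLp_four_slab_of_oseenForward hS hcont hK hmild h0
  obtain ⟨p, hp2, hsl⟩ := exists_rieszPressure_two_slab hu4
  have hsl' : ∀ᵐ t ∂(volume.restrict (Ioo 0 S)), ∀ φ : (EuclideanSpace ℝ (Fin 3)) → ℝ, ContDiff ℝ (⊤ : ℕ∞) φ →
      HasCompactSupport φ → ∫ x, p t x * (Δ φ) x = -∫ x, fderiv ℝ (fderiv ℝ φ) x (u t x) (u t x) := by
    filter_upwards [hsl] with t ht using ht.2
  have hNS := isDistributionalNSSolutionOn_slab_of_oseenForward hS hcont hK hdiv hmild hu4 hp2 hsl'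
  exact ⟨p, hu4, hp2, hsl, isSuitableWeakSolutionOn_slab_of_bounded_of_memLp_two hS hK hNS hp2⟩

end Literature.Analysis.FluidPDE

end
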